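import Summits.BirchSwinnertonDyer.Rank1Residual.Additive.TameBranchWildCharacter
import HarnessLib

/-!
# The Gauss–Jacobi identity behind the E-normalisation of Delbourgo's tame branch:
# `G(κ)·G_p(ε) = ε(−1)·τ(ε,ψ_κ)·G(κ·ε)` and `τ(ε,ψ_κ)·G(κ)·G_p(ε̄) = p·G(κ·ε̄)` — KERNEL PROOFS
# (sub-cell additive-p2, gen 20; cell `b2b-bsdres`; retires the author flag `Del02-ThmC-GaussJacobi` of
# the named fact `Delbourgo2002.thmC_charIdeal_dvd_tameBranch`, A227)

HONEST FRAMING (cell `b2b-bsdres`, run/shared/lean/b2b/bsd-rank1-residual/, verbatim in every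
file): the goal of the cell is to DELETE the COMBINATION-SHAPED residual classes of the
Birch–Swinnerton-Dyer formula for ALL analytic-rank `≤ 1` elliptic curves over `ℚ` — "full BSD
formula for every rank `≤ 1` curve in class `C`" assembled STRICTLY from published theorems — so
that the rank-`≤ 1` remainder becomes exactly the CONSTRUCTION-SHAPED classes, which are TYPED
(missing-input `Prop`s), NOT attempted. This is not "finishing BSD". Pure character-sum algebra over
`ℤ/p^m` (one auxiliary definition — the top-step restriction of an additive character — and theorems);
no named fact, nothing about elliptic curves, labels UNCHANGED, NOTHING booked.

## What and why

The module docstring of `Literature/NumberTheory/EllipticCurves/Delbourgo2002/RationalDivisibility.lean`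
identifies cc-typer-2's E-NORMALISED tame branch `B_E` (`IsTameBranchOf`, `TameBranchLower.lean`) with
Delbourgo's `(L_p^{an})^Δ` up to ONE constant, via Birch's formula and the identity
**`τ(ε,ψ_κ) · G(κ) · G_p(ε̄) = p · G(κ·ε̄)`** for a Dirichlet character `κ` mod `p^m` (`m ≥ 2`,
PRIMITIVE), a non-trivial character `ε` mod `p`, `G` the Gauss sum against an additive character `ψ`
of `ℤ/p^m`, `G_p` the Gauss sum against its top-step restriction `ψ_p(t) := ψ(t·p^{m−1})`
("`e(t/p) = e(t p^{m−1}/p^m)`"), and `τ(ε,ψ_κ) = ∑_t ε(t)κ(1 + t p^{m−1})` the intrinsic Gauss sum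
(`tameGaussSum`) — checked there numerically and flagged `Del02-ThmC-GaussJacobi` "kernel proof owed".
This file PROVES it:
* §1 `AddChar.restrictTop` (`ψ_p`), `restrictTop_apply[_castHom]`.
* §2 `sum_apply_sub_mul_eq` — for a unit `y`: `∑_t ε(t)·κ(y − t p^{m−1}) = ε(−1)·ε(ȳ)·τ(ε,ψ_κ)·κ(y)`
  (substitution `y − t p^{m−1} = y(1 − ȳ⁻¹ t p^{m−1})`, additivity of `ψ_κ` for `m ≥ 2`, Mathlib
  `gaussSum_mulShift`); for a non-unit `y` both sides vanish.
* §3 **`gaussSum_mul_gaussSum_restrictTop`**: `G(κ)·G_p(ε) = ε(−1)·τ(ε,ψ_κ)·G(κ·ε↑)` for EVERY `κ`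
  mod `p^m` and EVERY `ε` mod `p` (`ε↑ = changeLevel ε`; the substitution `y = x + t p^{m−1}`), and
  **`tameGaussSum_mul_gaussSum_mul_gaussSum_restrictTop`**: `τ(ε,ψ_κ)·G(κ)·G_p(ε̄) = p·G(κ·ε̄↑)`
  for `ε ≠ 1` and `κ` primitive (with cc-typer-2's `tameGaussSum_mul_tameGaussSum_inv`:
  `τ(ε,ψ_κ)τ(ε̄,ψ_κ) = ε(−1)p`). Equivalently the Jacobi sum `J(κ, ε↑) = G(κ)G_p(ε)/G(κε↑)` with one
  wildly ramified argument COLLAPSES to `ε(−1)τ(ε,ψ_κ)`.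
So the identification constant in A227's docstring is a theorem of the tree up to Birch's formula
(tree fact `ratTwistedSymbolSum_mul_plusPeriod`) and `G(χ)G(χ̄) = χ(−1)p^m`; the flag
`Del02-ThmC-GaussJacobi` can be RETIRED by the referee (the other two flags are untouched).

References: [MazurTateTeitelbaum1986Invent] §I.8 (Gauss sums in interpolation formulae);
[Washington1997] §6.1 (Gauss/Jacobi sums); `Additive/TameBranchWildCharacter.lean`,
`TameBranchGaussShift.lean` (cc-typer-2); Mathlib `Mathlib.NumberTheory.GaussSum`.
-/

noncomputable section

open scoped Classical

open Literature.NumberTheory.EllipticCurves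

namespace Summit.BirchSwinnertonDyer.Rank1Residual.Additive

section Restrict

variable {p : ℕ} [hp : Fact p.Prime] {m : ℕ} {R : Type*} [CommRing R]

/-- **The top-step restriction `ψ_p` of an additive character `ψ` of `ℤ/p^m`** (`1 ≤ m`): on `ℤ/p`,
`ψ_p(t) := ψ(t · p^{m−1})` (`t` represented in `[0,p)`; well defined and additive because
`t ↦ t·p^{m−1}` only depends on `t mod p`). For `ψ(x) = e(x/p^m)` this is `t ↦ e(t/p)` — the additive
character of the mod-`p` Gauss sum `G_p(ε)` in Delbourgo's `p^m/(a^m G(χ̄ε))`. [folklore] -/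
def AddChar.restrictTop (hm : 1 ≤ m) (ψ : AddChar (ZMod (p ^ m)) R) : AddChar (ZMod p) R where
  toFun t := ψ (((t.val : ℕ) : ZMod (p ^ m)) * (p : ZMod (p ^ m)) ^ (m - 1))
  map_zero_eq_one' := by simp
  map_add_eq_mul' s t := by
    rw [← AddChar.map_add_eq_mul]
    congr 1
    have hst : (((s + t).val : ℕ) : ZMod (p ^ m)) * (p : ZMod (p ^ m)) ^ (m - 1) =
        (((s.val : ℕ) : ZMod (p ^ m)) + ((t.val : ℕ) : ZMod (p ^ m))) *
          (p : ZMod (p ^ m)) ^ (m - 1) := by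
      apply mul_pow_pred_eq_of_cast_eq hm
      rw [map_add, map_natCast, map_natCast, map_natCast, ZMod.natCast_zmod_val,
        ZMod.natCast_zmod_val, ZMod.natCast_zmod_val]
    rw [hst, add_mul]

/-- Unfolding `ψ_p(t) = ψ(t·p^{m−1})`. [folklore] -/
theorem AddChar.restrictTop_apply (hm : 1 ≤ m) (ψ : AddChar (ZMod (p ^ m)) R) (t : ZMod p) :
    AddChar.restrictTop hm ψ t = ψ (((t.val : ℕ) : ZMod (p ^ m)) * (p : ZMod (p ^ m)) ^ (m - 1)) :=
  rfl

/-- `ψ_p(y mod p) = ψ(y·p^{m−1})` for every `y ∈ ℤ/p^m`. [folklore] -/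
theorem AddChar.restrictTop_apply_castHom (hm : 1 ≤ m) (ψ : AddChar (ZMod (p ^ m)) R)
    (y : ZMod (p ^ m)) :
    AddChar.restrictTop hm ψ (ZMod.castHom (dvd_pow_self p (by omega)) (ZMod p) y) =
      ψ (y * (p : ZMod (p ^ m)) ^ (m - 1)) := by
  rw [AddChar.restrictTop_apply]
  congr 1
  apply mul_pow_pred_eq_of_cast_eq hm
  rw [map_natCast, ZMod.natCast_zmod_val]

end Restrict

section GaussJacobi

variable {p : ℕ} [hp : Fact p.Prime] {m : ℕ}

/-- The reduction map `ℤ/p^m → ℤ/p` kills `t·p^{m−1}` (`2 ≤ m`, indeed `1 ≤ m - 1`... here `m ≥ 2`).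
[folklore] -/
theorem castHom_natCast_mul_pow_pred (hm : 2 ≤ m) (n : ℕ) :
    ZMod.castHom (dvd_pow_self p (by omega)) (ZMod p)
      ((n : ZMod (p ^ m)) * (p : ZMod (p ^ m)) ^ (m - 1)) = 0 := by
  rw [map_mul, map_pow, map_natCast, map_natCast, ZMod.natCast_self, zero_pow (by omega), mul_zero]

/-- **The inner sum at a UNIT `y`**: `∑_{t mod p} ε(t)·κ(y − t·p^{m−1}) = ε(−1)·ε(ȳ)·τ(ε,ψ_κ)·κ(y)`
(`ȳ = y mod p`; `y − t p^{m−1} = y·(1 − ȳ⁻¹t·p^{m−1})`, `κ(1 + s p^{m−1}) = ψ_κ(s)`, and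
`∑_t ε(t)ψ_κ(−ȳ⁻¹t) = ε(−ȳ)·τ(ε,ψ_κ)` by `gaussSum_mulShift`). [folklore] -/
theorem sum_apply_sub_mul_eq_of_isUnit (hm : 2 ≤ m) (κ : DirichletCharacter ℂ_[p] (p ^ m))
    (ε : DirichletCharacter ℂ_[p] p) (u : (ZMod (p ^ m))ˣ) :
    ∑ t : ZMod p, ε t * κ ((u : ZMod (p ^ m)) -
        ((t.val : ℕ) : ZMod (p ^ m)) * (p : ZMod (p ^ m)) ^ (m - 1)) =
      ε (-1) * ε (ZMod.castHom (dvd_pow_self p (by omega)) (ZMod p) (u : ZMod (p ^ m))) *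
        tameGaussSum p ε κ * κ (u : ZMod (p ^ m)) := by
  haveI : NeZero (p ^ m) := ⟨pow_ne_zero _ hp.out.ne_zero⟩
  set π : ZMod (p ^ m) →+* ZMod p := ZMod.castHom (dvd_pow_self p (by omega)) (ZMod p) with hπ
  -- the image `ū` of `u` is a unit of `ℤ/p`; `a := −ū⁻¹`
  set ub : (ZMod p)ˣ := Units.map (π : ZMod (p ^ m) →* ZMod p) u with hub
  have hub' : (ub : ZMod p) = π (u : ZMod (p ^ m)) := rfl
  set a : (ZMod p)ˣ := -ub⁻¹ with ha_def
  have ha : (a : ZMod p) = -(π ((u⁻¹ : (ZMod (p ^ m))ˣ) : ZMod (p ^ m))) := by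
    rw [ha_def, Units.val_neg, hub, ← map_inv, Units.coe_map]
    rfl
  have hainv : ((a⁻¹ : (ZMod p)ˣ) : ZMod p) = -(π (u : ZMod (p ^ m))) := by
    rw [ha_def, inv_neg, inv_inv, Units.val_neg, hub']
  -- rewrite each summand: `κ(u − t p^{m-1}) = κ(u) · ψ_κ(a t)`
  have hterm : ∀ t : ZMod p,
      κ ((u : ZMod (p ^ m)) - ((t.val : ℕ) : ZMod (p ^ m)) * (p : ZMod (p ^ m)) ^ (m - 1)) =
        κ (u : ZMod (p ^ m)) * wildAddChar hm κ ((a : ZMod p) * t) := by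
    intro t
    -- `u − t p^{m-1} = u · (1 + w p^{m-1})` with `w = −u⁻¹ t`
    have hu1 : (u : ZMod (p ^ m)) * ((u⁻¹ : (ZMod (p ^ m))ˣ) : ZMod (p ^ m)) = 1 := Units.mul_inv u
    have hfac : (u : ZMod (p ^ m)) - ((t.val : ℕ) : ZMod (p ^ m)) * (p : ZMod (p ^ m)) ^ (m - 1) =
        (u : ZMod (p ^ m)) * (1 + (-((u⁻¹ : (ZMod (p ^ m))ˣ) : ZMod (p ^ m)) *
          ((t.val : ℕ) : ZMod (p ^ m))) * (p : ZMod (p ^ m)) ^ (m - 1)) := by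
      linear_combination (((t.val : ℕ) : ZMod (p ^ m)) * (p : ZMod (p ^ m)) ^ (m - 1)) * hu1
    have harg : π (-((u⁻¹ : (ZMod (p ^ m))ˣ) : ZMod (p ^ m)) * ((t.val : ℕ) : ZMod (p ^ m))) =
        (a : ZMod p) * t := by
      rw [map_mul, map_neg, map_natCast, ZMod.natCast_zmod_val, ha]
    rw [hfac, map_mul, ← harg, wildAddChar_apply_castHom hm κ]
  simp_rw [hterm]
  -- `∑ ε t * (κ u * ψ_κ(a t)) = κ u * gaussSum ε (ψ_κ.mulShift a)`
  have hsum : ∑ t : ZMod p, ε t * (κ (u : ZMod (p ^ m)) * wildAddChar hm κ ((a : ZMod p) * t)) =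
      κ (u : ZMod (p ^ m)) * gaussSum ε ((wildAddChar hm κ).mulShift (a : ZMod p)) := by
    rw [gaussSum, Finset.mul_sum]
    refine Finset.sum_congr rfl fun t _ ↦ ?_
    rw [AddChar.mulShift_apply]
    ring
  rw [hsum]
  -- `ε a * gaussSum ε (ψ.mulShift a) = gaussSum ε ψ`, so `gaussSum ε (ψ.mulShift a) = ε a⁻¹ * gaussSum ε ψ`
  have hshift := gaussSum_mulShift ε (wildAddChar hm κ) a
  have hεa : ε ((a⁻¹ : (ZMod p)ˣ) : ZMod p) * ε (a : ZMod p) = 1 := by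
    rw [← map_mul, ← Units.val_mul, inv_mul_cancel, Units.val_one, map_one]
  have hG : gaussSum ε ((wildAddChar hm κ).mulShift (a : ZMod p)) =
      ε ((a⁻¹ : (ZMod p)ˣ) : ZMod p) * gaussSum ε (wildAddChar hm κ) := by
    have h := congrArg (fun z ↦ ε ((a⁻¹ : (ZMod p)ˣ) : ZMod p) * z) hshift
    rw [← mul_assoc, hεa, one_mul] at h
    exact h
  rw [hG, tameGaussSum_eq_gaussSum hm, hainv, ← neg_one_mul (π (u : ZMod (p ^ m))), map_mul]
  ring

/-- **The inner sum at a NON-UNIT `y`** vanishes termwise: `y − t·p^{m−1} ≡ y (mod p)` is a non-unit.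
[folklore] -/
theorem sum_apply_sub_mul_eq_zero_of_not_isUnit (hm : 2 ≤ m) (κ : DirichletCharacter ℂ_[p] (p ^ m))
    (ε : DirichletCharacter ℂ_[p] p) {y : ZMod (p ^ m)} (hy : ¬ IsUnit y) :
    ∑ t : ZMod p, ε t * κ (y - ((t.val : ℕ) : ZMod (p ^ m)) * (p : ZMod (p ^ m)) ^ (m - 1)) = 0 := by
  refine Finset.sum_eq_zero fun t _ ↦ ?_
  have hnu : ¬ IsUnit (y - ((t.val : ℕ) : ZMod (p ^ m)) * (p : ZMod (p ^ m)) ^ (m - 1)) := by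
    rw [isUnit_iff_isUnit_cast (by omega), map_sub, castHom_natCast_mul_pow_pred hm, sub_zero,
      ← isUnit_iff_isUnit_cast (by omega)]
    exact hy
  rw [κ.map_nonunit hnu, mul_zero]

/-- **`G(κ) · G_p(ε) = ε(−1) · τ(ε,ψ_κ) · G(κ·ε↑)`** for EVERY Dirichlet character `κ` mod `p^m`
(`m ≥ 2`), EVERY `ε` mod `p`, and every additive character `ψ` of `ℤ/p^m` (`G(χ) = gaussSum χ ψ`,
`G_p(ε) = gaussSum ε ψ_p` with `ψ_p = restrictTop ψ`, `ε↑ = changeLevel ε`): substitute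
`y = x + t·p^{m−1}` in the double sum and use the two inner-sum lemmas. [folklore] -/
theorem gaussSum_mul_gaussSum_restrictTop (hm : 2 ≤ m) (ψ : AddChar (ZMod (p ^ m)) ℂ_[p])
    (κ : DirichletCharacter ℂ_[p] (p ^ m)) (ε : DirichletCharacter ℂ_[p] p) :
    gaussSum κ ψ * gaussSum ε (AddChar.restrictTop (by omega : 1 ≤ m) ψ) =
      ε (-1) * tameGaussSum p ε κ *
        gaussSum (κ * DirichletCharacter.changeLevel (dvd_pow_self p (by omega)) ε) ψ := by
  haveI : NeZero (p ^ m) := ⟨pow_ne_zero _ hp.out.ne_zero⟩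
  set c : ZMod p → ZMod (p ^ m) := fun t ↦ ((t.val : ℕ) : ZMod (p ^ m)) * (p : ZMod (p ^ m)) ^ (m - 1)
    with hc
  -- expand the product and use additivity of `ψ`
  have h1 : gaussSum κ ψ * gaussSum ε (AddChar.restrictTop (by omega : 1 ≤ m) ψ) =
      ∑ t : ZMod p, ε t * ∑ x : ZMod (p ^ m), κ x * ψ (x + c t) := by
    rw [gaussSum, gaussSum, Finset.sum_mul_sum, Finset.sum_comm]
    refine Finset.sum_congr rfl fun t _ ↦ ?_
    rw [Finset.mul_sum]
    refine Finset.sum_congr rfl fun x _ ↦ ?_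
    rw [AddChar.restrictTop_apply, AddChar.map_add_eq_mul]
    ring
  -- reindex `x ↦ y = x + c t`
  have h2 : ∀ t : ZMod p, ∑ x : ZMod (p ^ m), κ x * ψ (x + c t) =
      ∑ y : ZMod (p ^ m), κ (y - c t) * ψ y := by
    intro t
    refine Finset.sum_equiv (Equiv.addRight (c t)) (fun _ ↦ by simp) fun x _ ↦ ?_
    simp [Equiv.coe_addRight, add_sub_cancel_right]
  simp_rw [h1, h2, Finset.mul_sum]
  rw [Finset.sum_comm]
  -- now `∑_y ∑_t ε t * (κ (y - c t) * ψ y) = ∑_y ψ y * (∑_t ε t * κ (y - c t))`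
  have h3 : ∀ y : ZMod (p ^ m), ∑ t : ZMod p, ε t * (κ (y - c t) * ψ y) =
      ψ y * ∑ t : ZMod p, ε t * κ (y - c t) := by
    intro y
    rw [Finset.mul_sum]
    exact Finset.sum_congr rfl fun t _ ↦ by ring
  simp_rw [h3]
  -- evaluate the inner sum
  set κε : DirichletCharacter ℂ_[p] (p ^ m) :=
    κ * DirichletCharacter.changeLevel (dvd_pow_self p (by omega)) ε with hκε
  have h4 : ∀ y : ZMod (p ^ m), ∑ t : ZMod p, ε t * κ (y - c t) =
      ε (-1) * tameGaussSum p ε κ * κε y := by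
    intro y
    by_cases hy : IsUnit y
    · obtain ⟨u, rfl⟩ := hy
      rw [sum_apply_sub_mul_eq_of_isUnit hm κ ε u, hκε, MulChar.mul_apply,
        DirichletCharacter.changeLevel_eq_cast_of_dvd ε (dvd_pow_self p (by omega)) u,
        ZMod.castHom_apply]
      ring
    · rw [sum_apply_sub_mul_eq_zero_of_not_isUnit hm κ ε hy, MulChar.map_nonunit κε hy, mul_zero]
  simp_rw [h4]
  rw [gaussSum, Finset.mul_sum]
  exact Finset.sum_congr rfl fun y _ ↦ by ring

/-- **`τ(ε,ψ_κ) · G(κ) · G_p(ε̄) = p · G(κ·ε̄↑)`** for `ε ≠ 1` mod `p` and `κ` PRIMITIVE mod `p^m`,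
`m ≥ 2` — the identity of A227's docstring (there: "`τ(ε,ψ_κ)·G(κ)·G(ε̄) = p·G(κε̄)`, checked
numerically"): the previous theorem for `ε̄ = ε⁻¹` times `τ(ε,ψ_κ)`, with
`τ(ε,ψ_κ)·τ(ε̄,ψ_κ) = ε(−1)·p` (`tameGaussSum_mul_tameGaussSum_inv`) and `ε(−1)² = 1`. Equivalently
`J(κ, ε̄↑) = p/τ(ε,ψ_κ) = ε(−1)τ(ε̄,ψ_κ)`. [folklore] -/
theorem tameGaussSum_mul_gaussSum_mul_gaussSum_restrictTop (hm : 2 ≤ m)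
    (ψ : AddChar (ZMod (p ^ m)) ℂ_[p]) {κ : DirichletCharacter ℂ_[p] (p ^ m)} (hκ : κ.IsPrimitive)
    {ε : DirichletCharacter ℂ_[p] p} (hε : ε ≠ 1) :
    tameGaussSum p ε κ * gaussSum κ ψ * gaussSum ε⁻¹ (AddChar.restrictTop (by omega : 1 ≤ m) ψ) =
      (p : ℂ_[p]) *
        gaussSum (κ * DirichletCharacter.changeLevel (dvd_pow_self p (by omega)) ε⁻¹) ψ := by
  rw [mul_assoc, gaussSum_mul_gaussSum_restrictTop hm ψ κ ε⁻¹, MulChar.inv_apply', inv_neg_one]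
  have hτ := tameGaussSum_mul_tameGaussSum_inv hm hε hκ
  have hεε := apply_neg_one_mul_apply_neg_one ε
  calc tameGaussSum p ε κ * (ε (-1) * tameGaussSum p ε⁻¹ κ *
        gaussSum (κ * DirichletCharacter.changeLevel (dvd_pow_self p (by omega)) ε⁻¹) ψ)
      = ε (-1) * (tameGaussSum p ε κ * tameGaussSum p ε⁻¹ κ) *
          gaussSum (κ * DirichletCharacter.changeLevel (dvd_pow_self p (by omega)) ε⁻¹) ψ := by ring
    _ = ε (-1) * (ε (-1) * p) *
          gaussSum (κ * DirichletCharacter.changeLevel (dvd_pow_self p (by omega)) ε⁻¹) ψ := by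
          rw [hτ]
    _ = _ := by rw [← mul_assoc, hεε, one_mul]

end GaussJacobi

end Summit.BirchSwinnertonDyer.Rank1Residual.Additive

end
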